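import Summits.CriticalPhenomena.PercolationContinuityZ3.Theorems.PercNearOneGluingNoHeavyLinearLowerTail
import HarnessLib

/-!
# Quantitative additive gluing, V: the MISSED-RELAY bound with the sharp constant — `E[#missed; o ↔ A] ≤ (|A| − 1)·s·μ(o ↔ A)` — and the linear
# lower tail with constant ONE on its first layer (`μ(N = 1) ≤ s·μ(o ↔ A)`; LNT♯-EN for `|A| ≤ 4`)

Support file (`--supports stmt-CriticalPhenomena-4575`), seat `prim-quant-p1` (lane QUANT, lead's assignment 2026-08-20T06:11Z: LNT♯-EN
`μ(1 ≤ N < EN/2) ≤ max_{a≠a'} μ(a ↮ a')·μ(o ↔ A)`); builds on p205010 (kernel theorem, internal audit signed; external expert review pending).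
No definitions, no named facts, no sorries; standard axioms.

Notation: `N = #{a ∈ A : o ↔ a}`, `U = {o ↔ A} = {N ≥ 1}`, `EN = Σ_a μ(o ↔ a)`, missed count `|A| − N`, `s ≥ μ(a ↮ a')` for all `a ≠ a'` in `A`.
The event gluing with a fixed target (`EventGluingSharp.eventGluing_sharp`) bounds EACH `μ(U ∩ {o ↮ a'}) ≤ s·μ(U)`, hence `E[|A| − N; U] ≤ |A|·s·μ(U)`
— the first-moment input of `linearLowerTail_two` (constant 2).  The master inequality (GEN) (`EventGluingSharp.gen_holds`) applied to the COUNTING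
functional `F(C) = |C ∩ A|` saves exactly one relay: the first relay met is never missed.

* `QuantGluing.missed_le` — `|A|·μ(U) − EN ≤ (|A| − 1)·s·μ(U)`, i.e. `E[|A| − N; U] ≤ (|A| − 1)·s·μ(U)` (sharp: equality when `o` is glued to one
  relay and the others form a block);
* `QuantGluing.lowCount_le` — Markov on top: `(|A| − j)·μ(1 ≤ N ∧ N ≤ j) ≤ (|A| − 1)·s·μ(U)` for every `j`;
* `QuantGluing.singleRelay_le` — the first layer with constant ONE, unconditionally: `μ(N = 1) ≤ s·μ(U)`;
* `QuantGluing.lntEN_card_le_four` — **LNT♯-EN for `|A| ≤ 4`**: `μ(1 ≤ N ∧ N < EN/2) ≤ s·μ(U)` (then `EN ≤ 4`, so the event is `{N = 1}`);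
* `QuantGluing.lntEN_markov` — for every `A`: `μ(1 ≤ N ∧ N < EN/2)·(|A| − j) ≤ (|A| − 1)·s·μ(U)` for any `j` with `EN ≤ 2(j+1)`, i.e. constant
  `(|A| − 1)/(|A| − j*) < 2` with `j* = ⌈EN/2⌉ − 1` — strictly between the kernel bounds `1` (conjectured, census n ≤ 7) and `2` (`quantLowerTailGluing_two`).
[cite: KozmaNitzan2024, Conj. 4 (p. 32), Conj. 1 (p. 3), Conjecture 3 (p. 15)]
-/

noncomputable section

namespace Summit.CriticalPhenomena.PercolationContinuityZ3.Theorems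

open MeasureTheory Set
open Literature.Probability.LatticeModels (prodBernoulli)
open Literature.Probability.Percolation
open scoped Classical

namespace QuantGluing

variable {n : ℕ}

/-- **The missed-relay bound with the sharp constant** (GEN at the counting functional): if `μ(a ↮ a') ≤ s` for all `a ≠ a'` in `A`, then
`|A|·μ(o ↔ A) − Σ_a μ(o ↔ a) ≤ (|A| − 1)·s·μ(o ↔ A)`, i.e. `E[#missed relays; o ↔ A] ≤ (|A| − 1)·s·μ(o ↔ A)`.  Proof: (GEN) with `F(C) = |C ∩ A|`
gives `EN ≥ Σ_a μ(P_a)·E|C(a) ∩ A| ≥ μ(U)·(1 + (|A| − 1)(1 − s))`. [cite: KozmaNitzan2024, Conj. 4 (p. 32)] -/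
theorem missed_le (n : ℕ) (w : Sym2 (Fin n) → unitInterval) (A : Finset (Fin n)) (o : Fin n) (s : ℝ)
    (hs : ∀ a ∈ A, ∀ a' ∈ A, a ≠ a' → (prodBernoulli w).real (openConn a a' : Set (BondConfig (Fin n)))ᶜ ≤ s) :
    (A.card : ℝ) * (prodBernoulli w).real (⋃ a ∈ A, openConn o a) - ∑ a ∈ A, (prodBernoulli w).real (openConn o a) ≤
      (A.card - 1) * s * (prodBernoulli w).real (⋃ a ∈ A, openConn o a) := by
  set μ := prodBernoulli w with hμ
  have hmeas : ∀ S : Set (BondConfig (Fin n)), MeasurableSet S := fun S => (Set.toFinite S).measurableSet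
  -- the counting functional
  set F : Set (Fin n) → ℝ := fun C => ((A.filter fun a => a ∈ C).card : ℝ) with hFdef
  have hFmono : ∀ S T : Set (Fin n), S ⊆ T → F S ≤ F T := by
    intro S T hST
    simp only [hFdef]
    exact_mod_cast Finset.card_le_card (fun a ha => by
      rw [Finset.mem_filter] at ha ⊢
      exact ⟨ha.1, hST ha.2⟩)
  have hF0 : ∀ S, 0 ≤ F S := fun S => by simp only [hFdef]; positivity
  -- `F(C_x(ω)) = Σ_{a' ∈ A} 1{x ↔ a'}(ω)`
  have hFsum : ∀ x : Fin n, (fun ω : BondConfig (Fin n) => F (openCluster ω x)) =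
      fun ω => ∑ a' ∈ A, (openConn x a' : Set (BondConfig (Fin n))).indicator (fun _ => (1 : ℝ)) ω := by
    intro x
    funext ω
    simp only [hFdef]
    rw [Finset.natCast_card_filter]
    refine Finset.sum_congr rfl fun a' _ => ?_
    by_cases h : ω ∈ (openConn x a' : Set (BondConfig (Fin n)))
    · rw [Set.indicator_of_mem h, if_pos (show a' ∈ openCluster ω x from h)]
    · rw [Set.indicator_of_notMem h, if_neg (show a' ∉ openCluster ω x from h)]
  have hint : ∀ x : Fin n, ∫ ω, F (openCluster ω x) ∂μ = ∑ a' ∈ A, μ.real (openConn x a') := by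
    intro x
    rw [hFsum x, integral_finsetSum _ (fun a' _ => (integrable_const (1 : ℝ)).indicator (hmeas _))]
    refine Finset.sum_congr rfl fun a' _ => ?_
    rw [integral_indicator_const _ (hmeas _), smul_eq_mul, mul_one]
  have hsetint : ∫ ω in (⋃ a ∈ A, openConn o a), F (openCluster ω o) ∂μ = ∑ a' ∈ A, μ.real (openConn o a') := by
    rw [hFsum o, integral_finsetSum _ (fun a' _ => ((integrable_const (1 : ℝ)).indicator (hmeas _)).integrableOn)]
    refine Finset.sum_congr rfl fun a' ha' => ?_
    rw [integral_indicator_const _ (hmeas _), smul_eq_mul, mul_one, measureReal_restrict_apply (hmeas _),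
      Set.inter_eq_left.2 (Set.subset_iUnion₂ (s := fun x (_ : x ∈ A) => (openConn o x : Set (BondConfig (Fin n)))) a' ha')]
  -- lower bound on the means: `E|C(a) ∩ A| ≥ 1 + (|A| − 1)(1 − s)`
  have hmean : ∀ a ∈ A, 1 + ((A.card : ℝ) - 1) * (1 - s) ≤ ∫ ω, F (openCluster ω a) ∂μ := by
    intro a ha
    rw [hint a, ← Finset.add_sum_erase A _ ha]
    have hself : μ.real (openConn a a : Set (BondConfig (Fin n))) = 1 := by
      have : (openConn a a : Set (BondConfig (Fin n))) = Set.univ :=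
        Set.eq_univ_of_forall fun ω => (SimpleGraph.Reachable.refl a : (openGraph ω).Reachable a a)
      rw [this, probReal_univ]
    rw [hself]
    have hcard : ((A.erase a).card : ℝ) = A.card - 1 := by
      rw [Finset.card_erase_of_mem ha]; push_cast [Nat.one_le_iff_ne_zero.2 (Finset.card_ne_zero_of_mem ha)]; ring
    have hterm : ∀ a' ∈ A.erase a, 1 - s ≤ μ.real (openConn a a' : Set (BondConfig (Fin n))) := by
      intro a' ha'
      obtain ⟨hne, ha'A⟩ := Finset.mem_erase.1 ha'
      have h := hs a ha a' ha'A (Ne.symm hne)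
      rw [probReal_compl_eq_one_sub (hmeas _)] at h
      linarith
    calc 1 + ((A.card : ℝ) - 1) * (1 - s) = 1 + ∑ a' ∈ A.erase a, (1 - s) := by rw [Finset.sum_const, nsmul_eq_mul, hcard]
      _ ≤ 1 + ∑ a' ∈ A.erase a, μ.real (openConn a a' : Set (BondConfig (Fin n))) := by
          linarith [Finset.sum_le_sum hterm]
  -- a compatible injective rank and (GEN)
  obtain ⟨r, hr, hrc⟩ := AGloc.exists_rank_compat A (fun a => ∫ ω, F (openCluster ω a) ∂μ)
  have key := EventGluingSharp.gen_holds n w A o F r hFmono hF0 hr (fun a ha a' ha' hlt => hrc a ha a' ha' hlt)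
  rw [← hμ] at key
  rw [hsetint] at key
  have hsum := AGloc.sum_measureReal_firstRank w A r o hr
  rw [← hμ] at hsum
  -- `Σ_a π_a m_a ≥ (Σ_a π_a)·(1 + (|A|−1)(1−s))`
  have hlow : (∑ a ∈ A, μ.real (openConn o a ∩ ⋂ a' ∈ A.filter (fun a' => r a' < r a), (openConn o a')ᶜ :
        Set (BondConfig (Fin n)))) * (1 + ((A.card : ℝ) - 1) * (1 - s)) ≤
      ∑ a ∈ A, μ.real (openConn o a ∩ ⋂ a' ∈ A.filter (fun a' => r a' < r a), (openConn o a')ᶜ :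
        Set (BondConfig (Fin n))) * ∫ ω, F (openCluster ω a) ∂μ := by
    rw [Finset.sum_mul]
    exact Finset.sum_le_sum fun a ha => mul_le_mul_of_nonneg_left (hmean a ha) measureReal_nonneg
  rw [hsum] at hlow
  nlinarith [hlow, key]

/-- **Markov on top of the missed-relay bound**: for every `j`, `(|A| − j)·μ(1 ≤ N ∧ N ≤ j) ≤ (|A| − 1)·s·μ(o ↔ A)` (on the event at least
`|A| − j` relays are missed). [cite: KozmaNitzan2024, Conjecture 3 (p. 15)] -/
theorem lowCount_le (n : ℕ) (w : Sym2 (Fin n) → unitInterval) (A : Finset (Fin n)) (o : Fin n) (s : ℝ) (j : ℕ)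
    (hs : ∀ a ∈ A, ∀ a' ∈ A, a ≠ a' → (prodBernoulli w).real (openConn a a' : Set (BondConfig (Fin n)))ᶜ ≤ s) :
    ((A.card : ℝ) - j) * (prodBernoulli w).real {ω : BondConfig (Fin n) | 1 ≤ (A.filter fun a => ω ∈ openConn o a).card ∧
        (A.filter fun a => ω ∈ openConn o a).card ≤ j} ≤
      (A.card - 1) * s * (prodBernoulli w).real (⋃ a ∈ A, openConn o a) := by
  set μ := prodBernoulli w with hμ
  have hmeas : ∀ S : Set (BondConfig (Fin n)), MeasurableSet S := fun S => (Set.toFinite S).measurableSet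
  set E : Set (BondConfig (Fin n)) := {ω | 1 ≤ (A.filter fun a => ω ∈ openConn o a).card ∧
      (A.filter fun a => ω ∈ openConn o a).card ≤ j} with hE
  set U : Set (BondConfig (Fin n)) := ⋃ a ∈ A, openConn o a with hU
  have hEU : E ⊆ U := by
    intro ω hω
    obtain ⟨h1, -⟩ := hω
    obtain ⟨a, ha⟩ := Finset.card_pos.1 h1
    rw [Finset.mem_filter] at ha
    exact Set.mem_biUnion (Finset.mem_coe.2 ha.1) ha.2
  -- counting on `E`: at least `|A| − j` relays missed
  have hcount : ((A.card : ℝ) - j) * μ.real E ≤ ∑ a' ∈ A, μ.real (E ∩ (openConn o a' : Set (BondConfig (Fin n)))ᶜ) := by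
    refine halfLeSevenForms_mul_measureReal_le_sum_inter μ A
      (fun a' => (openConn o a' : Set (BondConfig (Fin n)))ᶜ) (fun a _ => hmeas _) (hmeas E) ((A.card : ℝ) - j)
      fun ω hω => ?_
    rw [← halfLeSevenForms_card_filter_eq_sum_indicator]
    have hsplit := Finset.card_filter_add_card_filter_not (s := A) (fun a => ω ∈ openConn o a)
    obtain ⟨-, h2⟩ := hω
    have hcast : ((A.filter fun a => ω ∈ openConn o a).card : ℝ) +
        ((A.filter fun a => ¬ ω ∈ openConn o a).card : ℝ) = A.card := by exact_mod_cast hsplit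
    have h2' : ((A.filter fun a => ω ∈ openConn o a).card : ℝ) ≤ j := by exact_mod_cast h2
    have hrw : ((A.filter fun a => ω ∈ (openConn o a : Set (BondConfig (Fin n)))ᶜ).card : ℝ) =
        ((A.filter fun a => ¬ ω ∈ openConn o a).card : ℝ) := rfl
    rw [hrw]
    linarith
  -- the missed count on `E` is at most the missed count on `U`: `Σ_{a'} μ(U ∩ {o ↮ a'}) = |A|μ(U) − EN`
  have hmono : ∑ a' ∈ A, μ.real (E ∩ (openConn o a' : Set (BondConfig (Fin n)))ᶜ) ≤
      ∑ a' ∈ A, μ.real (U ∩ (openConn o a' : Set (BondConfig (Fin n)))ᶜ) :=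
    Finset.sum_le_sum fun a' _ => measureReal_mono (Set.inter_subset_inter_left _ hEU) (measure_ne_top _ _)
  have hsplit : ∀ a' ∈ A, μ.real (U ∩ (openConn o a' : Set (BondConfig (Fin n)))ᶜ) = μ.real U - μ.real (openConn o a') := by
    intro a' ha'
    have h := measureReal_inter_add_sdiff (μ := μ) (s := U) (hmeas (openConn o a')) (measure_ne_top _ _)
    rw [Set.sdiff_eq, Set.inter_eq_right.2 (Set.subset_iUnion₂ (s := fun x (_ : x ∈ A) => (openConn o x : Set (BondConfig (Fin n)))) a' ha')] at h
    linarith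
  have htot : ∑ a' ∈ A, μ.real (U ∩ (openConn o a' : Set (BondConfig (Fin n)))ᶜ) =
      A.card * μ.real U - ∑ a' ∈ A, μ.real (openConn o a') := by
    rw [Finset.sum_congr rfl hsplit, Finset.sum_sub_distrib, Finset.sum_const]; simp
  have hmiss := missed_le n w A o s hs
  rw [← hμ] at hmiss
  linarith [hcount, hmono, htot, hmiss]

/-- **The first layer of the linear lower tail with constant ONE** (unconditionally, `|A| ≥ 2`): if `μ(a ↮ a') ≤ s` for all `a ≠ a'` in `A` then
`μ(N = 1) ≤ s·μ(o ↔ A)` — the single caught relay misses all `|A| − 1` others (`lowCount_le` at `j = 1`).  Sharp: equality when `o` is glued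
to one relay and the others form a block.  (For `|A| = 1` the hypothesis is vacuous and the inequality false, whence `2 ≤ |A|`.)
[cite: KozmaNitzan2024, Conjecture 3 (p. 15)] -/
theorem singleRelay_le (n : ℕ) (w : Sym2 (Fin n) → unitInterval) (A : Finset (Fin n)) (o : Fin n) (s : ℝ) (hA : 2 ≤ A.card)
    (hs : ∀ a ∈ A, ∀ a' ∈ A, a ≠ a' → (prodBernoulli w).real (openConn a a' : Set (BondConfig (Fin n)))ᶜ ≤ s) :
    (prodBernoulli w).real {ω : BondConfig (Fin n) | (A.filter fun a => ω ∈ openConn o a).card = 1} ≤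
      s * (prodBernoulli w).real (⋃ a ∈ A, openConn o a) := by
  have h := lowCount_le n w A o s 1 hs
  have hset : {ω : BondConfig (Fin n) | (A.filter fun a => ω ∈ openConn o a).card = 1} =
      {ω | 1 ≤ (A.filter fun a => ω ∈ openConn o a).card ∧ (A.filter fun a => ω ∈ openConn o a).card ≤ 1} := by
    ext ω; simp only [Set.mem_setOf_eq]; omega
  rw [hset]
  have hpos : (0 : ℝ) < (A.card : ℝ) - 1 := by
    have : (2 : ℝ) ≤ A.card := by exact_mod_cast hA
    linarith
  have e : ((A.card : ℝ) - ((1 : ℕ) : ℝ)) = (A.card : ℝ) - 1 := by norm_num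
  rw [e] at h
  have h' : ((A.card : ℝ) - 1) * (prodBernoulli w).real {ω : BondConfig (Fin n) | 1 ≤ (A.filter fun a => ω ∈ openConn o a).card ∧
      (A.filter fun a => ω ∈ openConn o a).card ≤ 1} ≤ ((A.card : ℝ) - 1) * (s * (prodBernoulli w).real (⋃ a ∈ A, openConn o a)) := by
    linarith
  exact le_of_mul_le_mul_left h' hpos

/-- **LNT♯-EN for `|A| ≤ 4`**: `μ(1 ≤ N ∧ N < EN/2) ≤ s·μ(o ↔ A)` whenever `0 ≤ s` and `μ(a ↮ a') ≤ s` for all `a ≠ a'` in `A` — because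
`EN ≤ |A| ≤ 4` forces `N = 1` on the event (and for `|A| ≤ 1` the event is empty; `0 ≤ s` is needed only there). [cite: KozmaNitzan2024, Conjecture 3 (p. 15)] -/
theorem lntEN_card_le_four (n : ℕ) (w : Sym2 (Fin n) → unitInterval) (A : Finset (Fin n)) (o : Fin n) (s : ℝ) (hs0 : 0 ≤ s)
    (hA4 : A.card ≤ 4)
    (hs : ∀ a ∈ A, ∀ a' ∈ A, a ≠ a' → (prodBernoulli w).real (openConn a a' : Set (BondConfig (Fin n)))ᶜ ≤ s) :
    (prodBernoulli w).real {ω : BondConfig (Fin n) | 1 ≤ (A.filter fun a => ω ∈ openConn o a).card ∧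
        ((A.filter fun a => ω ∈ openConn o a).card : ℝ) < (∑ a ∈ A, (prodBernoulli w).real (openConn o a)) / 2} ≤
      s * (prodBernoulli w).real (⋃ a ∈ A, openConn o a) := by
  have hEN : (∑ a ∈ A, (prodBernoulli w).real (openConn o a : Set (BondConfig (Fin n)))) ≤ A.card := by
    calc (∑ a ∈ A, (prodBernoulli w).real (openConn o a : Set (BondConfig (Fin n)))) ≤ ∑ a ∈ A, (1 : ℝ) :=
          Finset.sum_le_sum fun a _ => measureReal_le_one
      _ = A.card := by simp
  have hA4' : (A.card : ℝ) ≤ 4 := by exact_mod_cast hA4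
  rcases Nat.lt_or_ge A.card 2 with hA | hA
  · -- `|A| ≤ 1`: the event is empty (`N ≥ 1` forces `N = |A| = 1`, while `EN ≤ 1 < 2N`)
    have hA1 : (A.card : ℝ) ≤ 1 := by exact_mod_cast Nat.lt_succ_iff.1 hA
    have hempty : {ω : BondConfig (Fin n) | 1 ≤ (A.filter fun a => ω ∈ openConn o a).card ∧
        ((A.filter fun a => ω ∈ openConn o a).card : ℝ) < (∑ a ∈ A, (prodBernoulli w).real (openConn o a)) / 2} = ∅ := by
      rw [Set.eq_empty_iff_forall_notMem]
      intro ω hω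
      obtain ⟨h1, h2⟩ := hω
      have h1' : (1 : ℝ) ≤ ((A.filter fun a => ω ∈ openConn o a).card : ℝ) := by exact_mod_cast h1
      linarith
    rw [hempty, measureReal_empty]
    exact mul_nonneg hs0 measureReal_nonneg
  · have hsub : {ω : BondConfig (Fin n) | 1 ≤ (A.filter fun a => ω ∈ openConn o a).card ∧
        ((A.filter fun a => ω ∈ openConn o a).card : ℝ) < (∑ a ∈ A, (prodBernoulli w).real (openConn o a)) / 2} ⊆
        {ω : BondConfig (Fin n) | (A.filter fun a => ω ∈ openConn o a).card = 1} := by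
      intro ω hω
      obtain ⟨h1, h2⟩ := hω
      have h3 : ((A.filter fun a => ω ∈ openConn o a).card : ℝ) < 2 := by linarith
      have h4 : (A.filter fun a => ω ∈ openConn o a).card < 2 := by exact_mod_cast h3
      show (A.filter fun a => ω ∈ openConn o a).card = 1
      omega
    exact (measureReal_mono hsub (measure_ne_top _ _)).trans (singleRelay_le n w A o s hA hs)

/-- **LNT♯-EN up to the Markov factor `(|A| − 1)/(|A| − j) < 2`**: for `0 ≤ s` and every `j` with `EN ≤ 2(j+1)` (e.g. `j = ⌈EN/2⌉ − 1`),
`(|A| − j)·μ(1 ≤ N ∧ N < EN/2) ≤ (|A| − 1)·s·μ(o ↔ A)` — between the conjectured constant `1` and the kernel constant `2` of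
`quantLowerTailGluing_two`. [cite: KozmaNitzan2024, Conjecture 3 (p. 15)] -/
theorem lntEN_markov (n : ℕ) (w : Sym2 (Fin n) → unitInterval) (A : Finset (Fin n)) (o : Fin n) (s : ℝ) (hs0 : 0 ≤ s) (j : ℕ)
    (hs : ∀ a ∈ A, ∀ a' ∈ A, a ≠ a' → (prodBernoulli w).real (openConn a a' : Set (BondConfig (Fin n)))ᶜ ≤ s)
    (hj : (∑ a ∈ A, (prodBernoulli w).real (openConn o a)) ≤ 2 * (j + 1)) :
    ((A.card : ℝ) - j) * (prodBernoulli w).real {ω : BondConfig (Fin n) | 1 ≤ (A.filter fun a => ω ∈ openConn o a).card ∧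
        ((A.filter fun a => ω ∈ openConn o a).card : ℝ) < (∑ a ∈ A, (prodBernoulli w).real (openConn o a)) / 2} ≤
      (A.card - 1) * s * (prodBernoulli w).real (⋃ a ∈ A, openConn o a) := by
  have h := lowCount_le n w A o s j hs
  have hsub : {ω : BondConfig (Fin n) | 1 ≤ (A.filter fun a => ω ∈ openConn o a).card ∧
        ((A.filter fun a => ω ∈ openConn o a).card : ℝ) < (∑ a ∈ A, (prodBernoulli w).real (openConn o a)) / 2} ⊆
      {ω : BondConfig (Fin n) | 1 ≤ (A.filter fun a => ω ∈ openConn o a).card ∧ (A.filter fun a => ω ∈ openConn o a).card ≤ j} := by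
    intro ω hω
    obtain ⟨h1, h2⟩ := hω
    refine ⟨h1, ?_⟩
    have h3 : ((A.filter fun a => ω ∈ openConn o a).card : ℝ) < j + 1 := by linarith
    have h4 : (A.filter fun a => ω ∈ openConn o a).card < j + 1 := by exact_mod_cast h3
    omega
  have hmono := measureReal_mono (μ := prodBernoulli w) hsub (measure_ne_top _ _)
  rcases le_or_gt ((A.card : ℝ) - j) 0 with hneg | hposj
  · -- `|A| ≤ j`: left side `≤ 0 ≤` right side
    have hL : ((A.card : ℝ) - j) * (prodBernoulli w).real {ω : BondConfig (Fin n) | 1 ≤ (A.filter fun a => ω ∈ openConn o a).card ∧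
        ((A.filter fun a => ω ∈ openConn o a).card : ℝ) < (∑ a ∈ A, (prodBernoulli w).real (openConn o a)) / 2} ≤ 0 :=
      mul_nonpos_of_nonpos_of_nonneg hneg measureReal_nonneg
    have hR : 0 ≤ ((A.card : ℝ) - 1) * s * (prodBernoulli w).real (⋃ a ∈ A, openConn o a) := by
      rcases A.eq_empty_or_nonempty with hAe | hne
      · subst hAe; simp
      · have : (1 : ℝ) ≤ A.card := by exact_mod_cast Finset.card_pos.2 hne
        exact mul_nonneg (mul_nonneg (by linarith) hs0) measureReal_nonneg
    linarith
  · have h0 : ((A.card : ℝ) - j) * (prodBernoulli w).real {ω : BondConfig (Fin n) | 1 ≤ (A.filter fun a => ω ∈ openConn o a).card ∧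
        ((A.filter fun a => ω ∈ openConn o a).card : ℝ) < (∑ a ∈ A, (prodBernoulli w).real (openConn o a)) / 2} ≤
        ((A.card : ℝ) - j) * (prodBernoulli w).real {ω : BondConfig (Fin n) | 1 ≤ (A.filter fun a => ω ∈ openConn o a).card ∧
          (A.filter fun a => ω ∈ openConn o a).card ≤ j} :=
      mul_le_mul_of_nonneg_left hmono hposj.le
    exact h0.trans h

end QuantGluing

end Summit.CriticalPhenomena.PercolationContinuityZ3.Theorems

end
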